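import Summits.PneNP.PneNP.Theses.ConvexRankGates
import Summits.PneNP.PneNP.Theorems.ConvexRankGatesCliqueExtLowerBoundWidthThresholdReduction
import Summits.PneNP.PneNP.Theorems.ConvexRankGatesCliqueExtLowerBoundStubConvLowDimStructure
import Summits.PneNP.PneNP.Theorems.ConvexRankGatesCliqueExtLowerBoundStubThresholdIntegerWeights
import Summits.PneNP.PneNP.Theorems.ConvexRankGatesCliqueExtLowerBoundStubIntegerThresholdCircuit
import Summits.PneNP.PneNP.Theorems.ConvexRankGatesCliqueExtLowerBoundStubAndThresholdAssembly

/-!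
# Calibration of the stub `stub_convHighDim` and the three-stub bridge (line
`width-threshold-certificate-sparsity`, crux `ConvexRankGates.CliqueExtLowerBound`, stmt-PneNP-10682,
route PneNP/ConvexRankGates)

The registered stub `stub_convHighDim` of the line's skeleton (r4) says: every CONV gate of width
`p + q ≤ m^c` whose psd variable has dimension `q ≥ 2` (genuine SDP feasibility
`∃ Y ⪰ 0, tr(Aᵢ Y) ≤ bᵢ + ∑ⱼ Bᵢⱼ[vⱼ]`), fed with local child pairs, is `(r,s)`-sandwichable on the
referee pair (bare `⌈m^{1/4}⌉₊`-cliques vs complements of the `#E/⌊m^{1/8}⌋₊`-edge graphs) with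
error `1/(8 m^{c+1})`. This file does NOT prove the stub (the single-gate content of crux #2
`ConvexGateBlind` on this pair; Oliveira–Pudlák's weak SDP clique detection problem). It records,
with the stub statement as an explicit hypothesis (written out verbatim, no abbreviating definition)
and everything else LANDED:

* `convSandwichable_of_convHighDim` (T1): the stub ⇒ ALL CONV gates of width `≤ m^c` are
  sandwichable — the `q ≤ 1` branch is the landed chain `ConvLowDim.stub_convLowDimStructure`
  (AND of `≤ (m^c+1)²` non-negative real thresholds) + `IntegerWeights.stub_thresholdIntegerWeights`
  (Muroga) + `ThresholdCircuit.stub_integerThresholdCircuit` (monotone threshold circuits) +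
  `AndThreshold.stub_andThresholdAssembly` (assembly, `Replaceable` + `InlineFree`);
* `convLowerBound_of_convHighDim` (T2): hence the lower bound over the CONV-only sub-basis
  `{∧₂, ∨₂} ∪ CONV_{m^c}` at `δ = 1/4`: for every `c`, eventually in `m`, no circuit with `≤ m^c`
  such gates computes `CLIQUE(m, ⌈m^{1/4}⌉₊)` (pattern `narrowLowerBound`: `∧₂, ∨₂ ∈ CONV₁`, the
  referee, `core`) — crux #2's schedule at `1/4`, with `∧/∨` interleaved;
* `oneConvGate_blind_of_convHighDim` (T3): hence NO single SDP-feasibility gate of width `≤ m^c`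
  (any arity, any wiring of its inputs to edges) computes `CLIQUE(m, ⌈m^{1/4}⌉₊)`, eventually in `m`;
* `cliqueExtLowerBound_of_three` (T4, REGISTERED): the crux `CliqueExtLowerBound` from the THREE open
  r4 stubs `stub_permSandwichable`, `stub_grankSandwichable`, `stub_convHighDim` (all verbatim, as
  hypotheses), via the landed bridge `cliqueExtLowerBound_of_sandwichable` and T1.

The hypothesis-generic forms (`convLowerBound_of_convSandwichable`,
`oneConvGate_blind_of_convLowerBound`) are recorded on the way.

References: S. Jukna, *Boolean Function Complexity* (2012), Thm. 9.17 [Jukna2012];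
I. C. Oliveira, P. Pudlák, *Monotone circuit lower bounds from robust sunflowers / weak MLP gates*
(2019), Def. 3.1 [OliveiraPudlak2019].
-/

set_option linter.dupNamespace false

open Literature.Computability.Complexity Filter Finset
open Summit.PneNP.PneNP.Theorems.CliqueExtLowerBound.WidthThreshold

noncomputable section

namespace Summit.PneNP.PneNP.Theorems.CliqueExtLowerBound.WidthThreshold.ConvCalibration

/-! ## §1 All CONV gates are sandwichable from the `q ≥ 2` stub -/

open Classical in
/-- **T1. The stub implies that EVERY CONV gate of width `≤ m^c` is sandwichable.** Under
`stub_convHighDim` (verbatim, as the arrow hypothesis): for every `c` there are thresholds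
`r₀, s₀ ≥ 2` such that for `r ≥ r₀`, `s ≥ s₀`, eventually in `m`, every `φ ∈ CONV_{m^c}` is
`(r,s)`-sandwichable on the referee pair with error `ε(m,c)`. Split a CONV witness by its psd
dimension `q`: `q ≥ 2` is the hypothesis; `q ≤ 1` is the landed chain
`stub_convLowDimStructure` → `stub_andThresholdAssembly stub_thresholdIntegerWeights
stub_integerThresholdCircuit`. [folklore] -/
theorem convSandwichable_of_convHighDim :
    (∀ c : ℕ, ∃ r₀ s₀ : ℕ, 2 ≤ r₀ ∧ 2 ≤ s₀ ∧ ∀ r s : ℕ, r₀ ≤ r → s₀ ≤ s →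
    ∀ᶠ m : ℕ in atTop, ∀ φ : GateFn,
      (∃ p q : ℕ, p + q ≤ m ^ c ∧ 2 ≤ q ∧ ∃ (A : Fin p → Matrix (Fin q) (Fin q) ℝ) (b : Fin p → ℝ)
        (B : Fin p → Fin φ.1 → ℝ), (∀ i j, 0 ≤ B i j) ∧ ∀ v : Fin φ.1 → Bool, φ.2 v = true ↔
          ∃ Y : Matrix (Fin q) (Fin q) ℝ, Y.PosSemidef ∧
            ∀ i, (A i * Y).trace ≤ b i + ∑ j, B i j * (if v j then (1 : ℝ) else 0)) →
      ∀ (D C : Fin φ.1 → Finset (Finset ((⊤ : SimpleGraph (Fin m)).edgeSet))),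
        #(univ.image fun j => (D j, C j)) ≤ m ^ (c + 3) →
        (∀ j, ∀ R ∈ D j, #R ≤ r - 1) → (∀ j, ∀ S ∈ C j, #S ≤ s - 1) →
        (∀ j x, EvalDNF (D j) x → EvalCNF (C j) x) →
        ∃ dnf cnf : Finset (Finset ((⊤ : SimpleGraph (Fin m)).edgeSet)),
          (∀ R ∈ dnf, #R ≤ r - 1) ∧ (∀ S ∈ cnf, #S ≤ s - 1) ∧
          (∀ x, EvalDNF dnf x → EvalCNF cnf x) ∧
          (#((posGraphs m ⌈(m : ℝ) ^ (1 / 4 : ℝ)⌉₊).filter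
              (fun x => φ.2 (fun j => decide (EvalDNF (D j) x)) = true ∧ ¬ EvalDNF dnf x)) : ℝ)
            ≤ (1 / (8 * (m : ℝ) ^ (c + 1))) * #(posGraphs m ⌈(m : ℝ) ^ (1 / 4 : ℝ)⌉₊) ∧
          (#((((powersetCard (Fintype.card ((⊤ : SimpleGraph (Fin m)).edgeSet) / ⌊(m : ℝ) ^ (1 / 8 : ℝ)⌋₊)
          (univ : Finset ((⊤ : SimpleGraph (Fin m)).edgeSet))).image (fun M => fun e => decide (e ∉ M)))).filter
              (fun x => EvalCNF cnf x ∧ φ.2 (fun j => decide (EvalCNF (C j) x)) = false)) : ℝ)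
            ≤ (1 / (8 * (m : ℝ) ^ (c + 1))) *
              #(((powersetCard (Fintype.card ((⊤ : SimpleGraph (Fin m)).edgeSet) / ⌊(m : ℝ) ^ (1 / 8 : ℝ)⌋₊)
          (univ : Finset ((⊤ : SimpleGraph (Fin m)).edgeSet))).image (fun M => fun e => decide (e ∉ M))))) →
    ∀ c : ℕ, ∃ r₀ s₀ : ℕ, 2 ≤ r₀ ∧ 2 ≤ s₀ ∧ ∀ r s : ℕ, r₀ ≤ r → s₀ ≤ s →
      ∀ᶠ m : ℕ in atTop, ∀ φ : GateFn, IsConvGate (m ^ c) φ →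
        Sandwichable r s (m ^ (c + 3)) (posFam m) (negFam m) (eps m c) φ := by
  intro hH c
  obtain ⟨r₁, s₁, hr₁, hs₁, hHi⟩ := hH c
  obtain ⟨r₂, s₂, hr₂, hs₂, hLo⟩ :=
    Summit.PneNP.PneNP.Theorems.CliqueExtLowerBound.WidthThreshold.AndThreshold.stub_andThresholdAssembly
      Summit.PneNP.PneNP.Theorems.CliqueExtLowerBound.WidthThreshold.IntegerWeights.stub_thresholdIntegerWeights
      Summit.PneNP.PneNP.Theorems.CliqueExtLowerBound.WidthThreshold.ThresholdCircuit.stub_integerThresholdCircuit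
      c
  refine ⟨max r₁ r₂, max s₁ s₂, le_trans hr₁ (le_max_left _ _), le_trans hs₁ (le_max_left _ _),
    fun r s hr hs => ?_⟩
  filter_upwards [hHi r s ((le_max_left _ _).trans hr) ((le_max_left _ _).trans hs),
    hLo r s ((le_max_right _ _).trans hr) ((le_max_right _ _).trans hs)] with m h₁ h₂ φ hφ
  obtain ⟨p, q, hpq, A, b, B, hB, hrep⟩ := hφ
  by_cases hq : q ≤ 1
  · exact h₂ φ
      (Summit.PneNP.PneNP.Theorems.CliqueExtLowerBound.WidthThreshold.ConvLowDim.stub_convLowDimStructure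
        (m ^ c) φ ⟨p, q, hpq, hq, A, b, B, hB, hrep⟩)
  · exact h₁ φ ⟨p, q, hpq, by omega, A, b, B, hB, hrep⟩

/-! ## §2 The CONV-only lower bound at `δ = 1/4` and single-gate blindness -/

/-- The CONV-only lower bound from CONV sandwichability (hypothesis-generic form of T2): if for every
`c`, for `r ≥ r₀(c)`, `s ≥ s₀(c)`, eventually in `m`, every `φ ∈ CONV_{m^c}` is `(r,s)`-sandwichable on
the referee pair with error `ε(m,c)`, then for every `c`, eventually in `m`, no circuit with `≤ m^c`
gates over `{∧₂, ∨₂} ∪ CONV_{m^c}` computes `CLIQUE(m, ⌈m^{1/4}⌉₊)`. Composition pattern of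
`narrowLowerBound`: `∧₂, ∨₂ ∈ CONV₁ ⊆ CONV_{m^c}` (`and_isConvGate`, `or_isConvGate`), every gate is
monotone (`IsConvGate.monotone`), intersect with `referee_statement s` and run `core`.
[cite: Jukna2012, Thm. 9.17] -/
theorem convLowerBound_of_convSandwichable :
    (∀ c : ℕ, ∃ r₀ s₀ : ℕ, 2 ≤ r₀ ∧ 2 ≤ s₀ ∧ ∀ r s : ℕ, r₀ ≤ r → s₀ ≤ s →
      ∀ᶠ m : ℕ in atTop, ∀ φ : GateFn, IsConvGate (m ^ c) φ →
        Sandwichable r s (m ^ (c + 3)) (posFam m) (negFam m) (eps m c) φ) →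
    ∀ c : ℕ, ∀ᶠ m : ℕ in atTop, ∀ C : Circuit ((⊤ : SimpleGraph (Fin m)).edgeSet),
      C.IsOver ({GateFn.and 2, GateFn.or 2} ∪ {g | IsConvGate (m ^ c) g}) →
        C.size ≤ m ^ c → ¬ C.Computes (cliqueFn m ⌈(m : ℝ) ^ (1 / 4 : ℝ)⌉₊) := by
  intro hS c
  obtain ⟨r, s, hr2, hs2, hW⟩ := hS c
  filter_upwards [hW r s le_rfl le_rfl, referee_statement s, eventually_ge_atTop 3] with m h₁ h₆ hm
    C hC hsize
  have h1c : 1 ≤ m ^ c := Nat.one_le_pow _ _ (by omega)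
  have hε0 : 0 ≤ eps m c := by unfold eps; positivity
  have hle : eps m c ≤ 2 * eps m c := by linarith
  refine core hr2 hs2 hm h₆.1 h₆.2
    (B := monotoneBasis ∪ {g | IsConvGate (m ^ c) g}) ?_ ?_ C hC hsize
  · rintro φ (hφ | hφ)
    · rcases hφ with rfl | rfl
      · exact GateFn.and_monotone 2
      · exact GateFn.or_monotone 2
    · exact IsConvGate.monotone hφ
  · rintro φ (hφ | hφ)
    · rcases hφ with rfl | rfl
      · exact (h₁ _ ((and_isConvGate 2).mono h1c)).of_le hle
      · exact (h₁ _ ((or_isConvGate 2).mono h1c)).of_le hle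
    · have hφ' : IsConvGate (m ^ c) φ := hφ
      exact (h₁ φ hφ').of_le hle

/-- Single-gate blindness from the CONV-only lower bound (hypothesis-generic form of T3): a lower
bound over `{∧₂, ∨₂} ∪ CONV_{m^c}` for `m^c`-size circuits forbids ONE CONV gate of width `≤ m^c` —
any arity `n`, input `i` reading the edge `w i`, repeated wires allowed — from computing
`CLIQUE(m, ⌈m^{1/4}⌉₊)`, eventually in `m` (it would be a size-`1` circuit over that basis,
`CktSize.gate`). [folklore] -/
theorem oneConvGate_blind_of_convLowerBound :
    (∀ c : ℕ, ∀ᶠ m : ℕ in atTop, ∀ C : Circuit ((⊤ : SimpleGraph (Fin m)).edgeSet),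
      C.IsOver ({GateFn.and 2, GateFn.or 2} ∪ {g | IsConvGate (m ^ c) g}) →
        C.size ≤ m ^ c → ¬ C.Computes (cliqueFn m ⌈(m : ℝ) ^ (1 / 4 : ℝ)⌉₊)) →
    ∀ c : ℕ, ∀ᶠ m : ℕ in atTop,
      ∀ (n : ℕ) (f : (Fin n → Bool) → Bool) (w : Fin n → (⊤ : SimpleGraph (Fin m)).edgeSet),
        IsConvGate (m ^ c) ⟨n, f⟩ →
        ¬ ∀ x : (⊤ : SimpleGraph (Fin m)).edgeSet → Bool,
          f (fun i => x (w i)) = cliqueFn m ⌈(m : ℝ) ^ (1 / 4 : ℝ)⌉₊ x := by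
  intro h c
  filter_upwards [h c, eventually_ge_atTop 1] with m hm h1 n f w hgate hcomp
  obtain ⟨C, hC, hs, he⟩ :=
    (CktSize.gate (B := {GateFn.and 2, GateFn.or 2} ∪ {g | IsConvGate (m ^ c) g}) ⟨n, f⟩
      (Or.inr hgate) w).toCircuit
  refine hm C hC (hs.trans (Nat.one_le_pow _ _ h1)) fun x => ?_
  rw [he x]
  exact hcomp x

open Classical in
/-- **T2. The stub implies the CONV-only lower bound at `δ = 1/4`.** Under `stub_convHighDim`
(verbatim, as the arrow hypothesis): for every `c`, eventually in `m`, no circuit with `≤ m^c` gates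
over `{∧₂, ∨₂} ∪ CONV_{m^c}` — SDP-feasibility gates of width `≤ m^c` of any fan-in, freely
interleaved with `∧/∨` — computes `CLIQUE(m, ⌈m^{1/4}⌉₊)`: the schedule `δ = 1/4` of crux #2
`ConvexGateBlind` of the route. T1 fed into `convLowerBound_of_convSandwichable`.
[cite: Jukna2012, Thm. 9.17] -/
theorem convLowerBound_of_convHighDim :
    (∀ c : ℕ, ∃ r₀ s₀ : ℕ, 2 ≤ r₀ ∧ 2 ≤ s₀ ∧ ∀ r s : ℕ, r₀ ≤ r → s₀ ≤ s →
    ∀ᶠ m : ℕ in atTop, ∀ φ : GateFn,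
      (∃ p q : ℕ, p + q ≤ m ^ c ∧ 2 ≤ q ∧ ∃ (A : Fin p → Matrix (Fin q) (Fin q) ℝ) (b : Fin p → ℝ)
        (B : Fin p → Fin φ.1 → ℝ), (∀ i j, 0 ≤ B i j) ∧ ∀ v : Fin φ.1 → Bool, φ.2 v = true ↔
          ∃ Y : Matrix (Fin q) (Fin q) ℝ, Y.PosSemidef ∧
            ∀ i, (A i * Y).trace ≤ b i + ∑ j, B i j * (if v j then (1 : ℝ) else 0)) →
      ∀ (D C : Fin φ.1 → Finset (Finset ((⊤ : SimpleGraph (Fin m)).edgeSet))),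
        #(univ.image fun j => (D j, C j)) ≤ m ^ (c + 3) →
        (∀ j, ∀ R ∈ D j, #R ≤ r - 1) → (∀ j, ∀ S ∈ C j, #S ≤ s - 1) →
        (∀ j x, EvalDNF (D j) x → EvalCNF (C j) x) →
        ∃ dnf cnf : Finset (Finset ((⊤ : SimpleGraph (Fin m)).edgeSet)),
          (∀ R ∈ dnf, #R ≤ r - 1) ∧ (∀ S ∈ cnf, #S ≤ s - 1) ∧
          (∀ x, EvalDNF dnf x → EvalCNF cnf x) ∧
          (#((posGraphs m ⌈(m : ℝ) ^ (1 / 4 : ℝ)⌉₊).filter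
              (fun x => φ.2 (fun j => decide (EvalDNF (D j) x)) = true ∧ ¬ EvalDNF dnf x)) : ℝ)
            ≤ (1 / (8 * (m : ℝ) ^ (c + 1))) * #(posGraphs m ⌈(m : ℝ) ^ (1 / 4 : ℝ)⌉₊) ∧
          (#((((powersetCard (Fintype.card ((⊤ : SimpleGraph (Fin m)).edgeSet) / ⌊(m : ℝ) ^ (1 / 8 : ℝ)⌋₊)
          (univ : Finset ((⊤ : SimpleGraph (Fin m)).edgeSet))).image (fun M => fun e => decide (e ∉ M)))).filter
              (fun x => EvalCNF cnf x ∧ φ.2 (fun j => decide (EvalCNF (C j) x)) = false)) : ℝ)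
            ≤ (1 / (8 * (m : ℝ) ^ (c + 1))) *
              #(((powersetCard (Fintype.card ((⊤ : SimpleGraph (Fin m)).edgeSet) / ⌊(m : ℝ) ^ (1 / 8 : ℝ)⌋₊)
          (univ : Finset ((⊤ : SimpleGraph (Fin m)).edgeSet))).image (fun M => fun e => decide (e ∉ M))))) →
    ∀ c : ℕ, ∀ᶠ m : ℕ in atTop, ∀ C : Circuit ((⊤ : SimpleGraph (Fin m)).edgeSet),
      C.IsOver ({GateFn.and 2, GateFn.or 2} ∪ {g | IsConvGate (m ^ c) g}) →
        C.size ≤ m ^ c → ¬ C.Computes (cliqueFn m ⌈(m : ℝ) ^ (1 / 4 : ℝ)⌉₊) :=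
  fun hH => convLowerBound_of_convSandwichable (convSandwichable_of_convHighDim hH)

open Classical in
/-- **T3. The stub forbids ONE SDP-feasibility gate.** Under `stub_convHighDim` (verbatim, as the
arrow hypothesis): for every `c`, eventually in `m`, NO single CONV gate of width `≤ m^c` — any
arity `n`, any wiring `w` of its inputs to the edge slots (repetitions allowed) — computes
`CLIQUE(m, ⌈m^{1/4}⌉₊)` (Oliveira–Pudlák's single weak-SDP-gate question on this schedule).
T2 fed into `oneConvGate_blind_of_convLowerBound`. [folklore] -/
theorem oneConvGate_blind_of_convHighDim :
    (∀ c : ℕ, ∃ r₀ s₀ : ℕ, 2 ≤ r₀ ∧ 2 ≤ s₀ ∧ ∀ r s : ℕ, r₀ ≤ r → s₀ ≤ s →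
    ∀ᶠ m : ℕ in atTop, ∀ φ : GateFn,
      (∃ p q : ℕ, p + q ≤ m ^ c ∧ 2 ≤ q ∧ ∃ (A : Fin p → Matrix (Fin q) (Fin q) ℝ) (b : Fin p → ℝ)
        (B : Fin p → Fin φ.1 → ℝ), (∀ i j, 0 ≤ B i j) ∧ ∀ v : Fin φ.1 → Bool, φ.2 v = true ↔
          ∃ Y : Matrix (Fin q) (Fin q) ℝ, Y.PosSemidef ∧
            ∀ i, (A i * Y).trace ≤ b i + ∑ j, B i j * (if v j then (1 : ℝ) else 0)) →
      ∀ (D C : Fin φ.1 → Finset (Finset ((⊤ : SimpleGraph (Fin m)).edgeSet))),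
        #(univ.image fun j => (D j, C j)) ≤ m ^ (c + 3) →
        (∀ j, ∀ R ∈ D j, #R ≤ r - 1) → (∀ j, ∀ S ∈ C j, #S ≤ s - 1) →
        (∀ j x, EvalDNF (D j) x → EvalCNF (C j) x) →
        ∃ dnf cnf : Finset (Finset ((⊤ : SimpleGraph (Fin m)).edgeSet)),
          (∀ R ∈ dnf, #R ≤ r - 1) ∧ (∀ S ∈ cnf, #S ≤ s - 1) ∧
          (∀ x, EvalDNF dnf x → EvalCNF cnf x) ∧
          (#((posGraphs m ⌈(m : ℝ) ^ (1 / 4 : ℝ)⌉₊).filter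
              (fun x => φ.2 (fun j => decide (EvalDNF (D j) x)) = true ∧ ¬ EvalDNF dnf x)) : ℝ)
            ≤ (1 / (8 * (m : ℝ) ^ (c + 1))) * #(posGraphs m ⌈(m : ℝ) ^ (1 / 4 : ℝ)⌉₊) ∧
          (#((((powersetCard (Fintype.card ((⊤ : SimpleGraph (Fin m)).edgeSet) / ⌊(m : ℝ) ^ (1 / 8 : ℝ)⌋₊)
          (univ : Finset ((⊤ : SimpleGraph (Fin m)).edgeSet))).image (fun M => fun e => decide (e ∉ M)))).filter
              (fun x => EvalCNF cnf x ∧ φ.2 (fun j => decide (EvalCNF (C j) x)) = false)) : ℝ)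
            ≤ (1 / (8 * (m : ℝ) ^ (c + 1))) *
              #(((powersetCard (Fintype.card ((⊤ : SimpleGraph (Fin m)).edgeSet) / ⌊(m : ℝ) ^ (1 / 8 : ℝ)⌋₊)
          (univ : Finset ((⊤ : SimpleGraph (Fin m)).edgeSet))).image (fun M => fun e => decide (e ∉ M))))) →
    ∀ c : ℕ, ∀ᶠ m : ℕ in atTop,
      ∀ (n : ℕ) (f : (Fin n → Bool) → Bool) (w : Fin n → (⊤ : SimpleGraph (Fin m)).edgeSet),
        IsConvGate (m ^ c) ⟨n, f⟩ →
        ¬ ∀ x : (⊤ : SimpleGraph (Fin m)).edgeSet → Bool,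
          f (fun i => x (w i)) = cliqueFn m ⌈(m : ℝ) ^ (1 / 4 : ℝ)⌉₊ x :=
  fun hH => oneConvGate_blind_of_convLowerBound (convLowerBound_of_convHighDim hH)

/-! ## §3 The bridge: the crux from the three open stubs of r4 -/

open Classical in
/-- **T4 (REGISTERED). The crux from the three open r4 stubs.** If every wide PERM gate
(`stub_permSandwichable`), every wide GRANK gate (`stub_grankSandwichable`) and every CONV gate with
psd dimension `q ≥ 2` (`stub_convHighDim`) — all three verbatim, as arrow hypotheses — fed with
local child pairs is `(r,s)`-sandwichable on the referee pair with error `1/(8m^{c+1})`, then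
`CliqueExtLowerBound` holds (at `δ = 1/4`): combine PERM ∨ GRANK into the wide-algebraic statement,
take the CONV statement from T1, and apply the landed bridge `cliqueExtLowerBound_of_sandwichable`
(engine, inline freeness, width threshold, referee, `core`, `Negative.cliqueExtLowerBound_iff`).
[cite: Jukna2012, Thm. 9.17] -/
theorem cliqueExtLowerBound_of_three :
    (∀ c : ℕ, ∃ r₀ s₀ : ℕ, 2 ≤ r₀ ∧ 2 ≤ s₀ ∧ ∀ r s : ℕ, r₀ ≤ r → s₀ ≤ s →
    ∀ᶠ m : ℕ in atTop, ∀ φ : GateFn, IsPermGate (m ^ c) φ →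
      ¬ (IsPermGate ⌊(m : ℝ) ^ (1 / 16 : ℝ)⌋₊ φ ∨ IsGRankGate ⌊(m : ℝ) ^ (1 / 16 : ℝ)⌋₊ φ) →
      ∀ (D C : Fin φ.1 → Finset (Finset ((⊤ : SimpleGraph (Fin m)).edgeSet))),
        #(univ.image fun j => (D j, C j)) ≤ m ^ (c + 3) →
        (∀ j, ∀ R ∈ D j, #R ≤ r - 1) → (∀ j, ∀ S ∈ C j, #S ≤ s - 1) →
        (∀ j x, EvalDNF (D j) x → EvalCNF (C j) x) →
        ∃ dnf cnf : Finset (Finset ((⊤ : SimpleGraph (Fin m)).edgeSet)),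
          (∀ R ∈ dnf, #R ≤ r - 1) ∧ (∀ S ∈ cnf, #S ≤ s - 1) ∧
          (∀ x, EvalDNF dnf x → EvalCNF cnf x) ∧
          (#((posGraphs m ⌈(m : ℝ) ^ (1 / 4 : ℝ)⌉₊).filter
              (fun x => φ.2 (fun j => decide (EvalDNF (D j) x)) = true ∧ ¬ EvalDNF dnf x)) : ℝ)
            ≤ (1 / (8 * (m : ℝ) ^ (c + 1))) * #(posGraphs m ⌈(m : ℝ) ^ (1 / 4 : ℝ)⌉₊) ∧
          (#((((powersetCard (Fintype.card ((⊤ : SimpleGraph (Fin m)).edgeSet) / ⌊(m : ℝ) ^ (1 / 8 : ℝ)⌋₊)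
          (univ : Finset ((⊤ : SimpleGraph (Fin m)).edgeSet))).image (fun M => fun e => decide (e ∉ M)))).filter
              (fun x => EvalCNF cnf x ∧ φ.2 (fun j => decide (EvalCNF (C j) x)) = false)) : ℝ)
            ≤ (1 / (8 * (m : ℝ) ^ (c + 1))) *
              #(((powersetCard (Fintype.card ((⊤ : SimpleGraph (Fin m)).edgeSet) / ⌊(m : ℝ) ^ (1 / 8 : ℝ)⌋₊)
          (univ : Finset ((⊤ : SimpleGraph (Fin m)).edgeSet))).image (fun M => fun e => decide (e ∉ M))))) →
    (∀ c : ℕ, ∃ r₀ s₀ : ℕ, 2 ≤ r₀ ∧ 2 ≤ s₀ ∧ ∀ r s : ℕ, r₀ ≤ r → s₀ ≤ s →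
    ∀ᶠ m : ℕ in atTop, ∀ φ : GateFn, IsGRankGate (m ^ c) φ →
      ¬ (IsPermGate ⌊(m : ℝ) ^ (1 / 16 : ℝ)⌋₊ φ ∨ IsGRankGate ⌊(m : ℝ) ^ (1 / 16 : ℝ)⌋₊ φ) →
      ∀ (D C : Fin φ.1 → Finset (Finset ((⊤ : SimpleGraph (Fin m)).edgeSet))),
        #(univ.image fun j => (D j, C j)) ≤ m ^ (c + 3) →
        (∀ j, ∀ R ∈ D j, #R ≤ r - 1) → (∀ j, ∀ S ∈ C j, #S ≤ s - 1) →
        (∀ j x, EvalDNF (D j) x → EvalCNF (C j) x) →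
        ∃ dnf cnf : Finset (Finset ((⊤ : SimpleGraph (Fin m)).edgeSet)),
          (∀ R ∈ dnf, #R ≤ r - 1) ∧ (∀ S ∈ cnf, #S ≤ s - 1) ∧
          (∀ x, EvalDNF dnf x → EvalCNF cnf x) ∧
          (#((posGraphs m ⌈(m : ℝ) ^ (1 / 4 : ℝ)⌉₊).filter
              (fun x => φ.2 (fun j => decide (EvalDNF (D j) x)) = true ∧ ¬ EvalDNF dnf x)) : ℝ)
            ≤ (1 / (8 * (m : ℝ) ^ (c + 1))) * #(posGraphs m ⌈(m : ℝ) ^ (1 / 4 : ℝ)⌉₊) ∧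
          (#((((powersetCard (Fintype.card ((⊤ : SimpleGraph (Fin m)).edgeSet) / ⌊(m : ℝ) ^ (1 / 8 : ℝ)⌋₊)
          (univ : Finset ((⊤ : SimpleGraph (Fin m)).edgeSet))).image (fun M => fun e => decide (e ∉ M)))).filter
              (fun x => EvalCNF cnf x ∧ φ.2 (fun j => decide (EvalCNF (C j) x)) = false)) : ℝ)
            ≤ (1 / (8 * (m : ℝ) ^ (c + 1))) *
              #(((powersetCard (Fintype.card ((⊤ : SimpleGraph (Fin m)).edgeSet) / ⌊(m : ℝ) ^ (1 / 8 : ℝ)⌋₊)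
          (univ : Finset ((⊤ : SimpleGraph (Fin m)).edgeSet))).image (fun M => fun e => decide (e ∉ M))))) →
    (∀ c : ℕ, ∃ r₀ s₀ : ℕ, 2 ≤ r₀ ∧ 2 ≤ s₀ ∧ ∀ r s : ℕ, r₀ ≤ r → s₀ ≤ s →
    ∀ᶠ m : ℕ in atTop, ∀ φ : GateFn,
      (∃ p q : ℕ, p + q ≤ m ^ c ∧ 2 ≤ q ∧ ∃ (A : Fin p → Matrix (Fin q) (Fin q) ℝ) (b : Fin p → ℝ)
        (B : Fin p → Fin φ.1 → ℝ), (∀ i j, 0 ≤ B i j) ∧ ∀ v : Fin φ.1 → Bool, φ.2 v = true ↔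
          ∃ Y : Matrix (Fin q) (Fin q) ℝ, Y.PosSemidef ∧
            ∀ i, (A i * Y).trace ≤ b i + ∑ j, B i j * (if v j then (1 : ℝ) else 0)) →
      ∀ (D C : Fin φ.1 → Finset (Finset ((⊤ : SimpleGraph (Fin m)).edgeSet))),
        #(univ.image fun j => (D j, C j)) ≤ m ^ (c + 3) →
        (∀ j, ∀ R ∈ D j, #R ≤ r - 1) → (∀ j, ∀ S ∈ C j, #S ≤ s - 1) →
        (∀ j x, EvalDNF (D j) x → EvalCNF (C j) x) →
        ∃ dnf cnf : Finset (Finset ((⊤ : SimpleGraph (Fin m)).edgeSet)),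
          (∀ R ∈ dnf, #R ≤ r - 1) ∧ (∀ S ∈ cnf, #S ≤ s - 1) ∧
          (∀ x, EvalDNF dnf x → EvalCNF cnf x) ∧
          (#((posGraphs m ⌈(m : ℝ) ^ (1 / 4 : ℝ)⌉₊).filter
              (fun x => φ.2 (fun j => decide (EvalDNF (D j) x)) = true ∧ ¬ EvalDNF dnf x)) : ℝ)
            ≤ (1 / (8 * (m : ℝ) ^ (c + 1))) * #(posGraphs m ⌈(m : ℝ) ^ (1 / 4 : ℝ)⌉₊) ∧
          (#((((powersetCard (Fintype.card ((⊤ : SimpleGraph (Fin m)).edgeSet) / ⌊(m : ℝ) ^ (1 / 8 : ℝ)⌋₊)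
          (univ : Finset ((⊤ : SimpleGraph (Fin m)).edgeSet))).image (fun M => fun e => decide (e ∉ M)))).filter
              (fun x => EvalCNF cnf x ∧ φ.2 (fun j => decide (EvalCNF (C j) x)) = false)) : ℝ)
            ≤ (1 / (8 * (m : ℝ) ^ (c + 1))) *
              #(((powersetCard (Fintype.card ((⊤ : SimpleGraph (Fin m)).edgeSet) / ⌊(m : ℝ) ^ (1 / 8 : ℝ)⌋₊)
          (univ : Finset ((⊤ : SimpleGraph (Fin m)).edgeSet))).image (fun M => fun e => decide (e ∉ M))))) →
    Summit.PneNP.PneNP.Theses.ConvexRankGates.CliqueExtLowerBound := by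
  intro hP hG hH
  refine cliqueExtLowerBound_of_sandwichable (fun c => ?_) (convSandwichable_of_convHighDim hH)
  obtain ⟨r₁, s₁, hr₁, hs₁, h₁⟩ := hP c
  obtain ⟨r₂, s₂, hr₂, hs₂, h₂⟩ := hG c
  refine ⟨max r₁ r₂, max s₁ s₂, le_trans hr₁ (le_max_left _ _), le_trans hs₁ (le_max_left _ _),
    fun r s hr hs => ?_⟩
  filter_upwards [h₁ r s ((le_max_left _ _).trans hr) ((le_max_left _ _).trans hs),
    h₂ r s ((le_max_right _ _).trans hr) ((le_max_right _ _).trans hs)] with m e₁ e₂ φ hφ hn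
  rcases hφ with hφ | hφ
  · exact e₁ φ hφ hn
  · exact e₂ φ hφ hn

end Summit.PneNP.PneNP.Theorems.CliqueExtLowerBound.WidthThreshold.ConvCalibration

end
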